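import Summits.ValiantsHypothesis.ValiantsHypothesis.Theorems.KPlusLogSqLawStaticPathFold
import Summits.ValiantsHypothesis.ValiantsHypothesis.Theorems.KPlusLogSqLawStaticPathMixedEventsTips

/-!
# Route «KPlusLogSqLaw» — parametric max-weight independent set on a path: events with a VIRTUAL or KILLING right wall are at most `4(n+1)`

HONEST FRAMING.  Helper toward the crux `WeakLifting` (item `stmt-ValiantsHypothesis-19561`, route `KPlusLogSqLaw`, cell `pub-symmetroid`,
seat val-sym-lift-p4 g21, 2026-08-29) on the line of its witness-plan stub `stub_tridiagonalSectorB` (tropical twin of the STATIC tridiagonal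
sector = parametric maximum-weight independent set on a path).  Kernel form of Proposition 1 of the lineage memo `HOME/val-sym-lift-p4/ORDER.md`
(val-sym-lift-p4 g10, the «wall-type» reduction of the ORDER QUESTION).  Setting of `…StaticPathMixedEvents` (THEOREM T): lines
`L a b 0, …, L a b n` (the signed prefix sums), even lines belong ABOVE a point, odd lines BELOW (`gap`).  An (M)-pair `p < q` («every line strictly
between is correct at the vertex of `p` and `q`») is retired on the RIGHT by the first later line `c > q` incorrect at that vertex — its RIGHT WALL;
the wall is VIRTUAL if there is none (`c = n + 1`), KILLING if no parameter at all has every line of `(p, c]` strictly correct against line `p`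
(the window of line `p` dies at step `c`), CUTTING otherwise.  Here, by one-dimensional affine reasoning ALONG THE LINE `p` (the signed gap of any
line against `L p` is affine in the parameter, `gap_along_line`): (1) `three_partners` — three partners `q₁, q₂, q₃` of one line `p`, each with every
line of `(p, m]` other than itself strictly correct at its crossing with `p`, are impossible (the middle crossing); hence (2) `card_partners_le_two` —
at most TWO such partners per line (⇒ at most 2 (M)-pairs `(p, ·)` with a virtual right wall), (3) `exists_all_pos_near` + `kill_index_eq` — all
(M)-pairs `(p, ·)` with a killing right wall share the killing index, so (4) `card_killed_partners_le_two` — at most TWO of them per line; and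
(5) **`card_rightWall_virtual_or_killing_le`** — the (M)-pairs whose right wall is virtual or killing number at most `4 (n + 1)` in total (no parity
or (L)/(R) condition is needed; events are (M)-pairs).  With the mirror statement for left walls this is ORDER.md's corollary «bp ≤ 8(n+1) + #CC»:
the ORDER QUESTION (is the number of breakpoints `O(n)`?) is carried by the CUT–CUT events alone.  Statements about a labelled line arrangement;
nothing here asserts anything about `WeakLifting`, `TropicalB`, `KPlusLogSqLaw`, the stub in its window, `MatrixDescartes`
(stmt-ValiantsHypothesis-18050) or `VP ≠ VNP`; the cut–cut class and the ORDER QUESTION stay open.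
-/

set_option linter.dupNamespace false
set_option autoImplicit false

namespace Summit.ValiantsHypothesis.ValiantsHypothesis.Theorems.KPlusLogSqLaw

open Finset Classical

namespace StaticPathFold

noncomputable section

variable (a b : ℕ → ℝ)

/-! ## 1. Along a fixed line: the signed gap is affine, and it vanishes at a crossing -/

/-- the signed gap of line `t` against line `p` is an affine function of the parameter. [folklore] -/
theorem gap_along_line (p t : ℕ) (θ : ℝ) :
    gap t (L a b p θ) (L a b t θ) =
      (if Even t then a t - a p else a p - a t) * θ + (if Even t then b t - b p else b p - b t) := by
  unfold gap L
  split_ifs <;> ring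

/-- hence strict correctness against line `p` at two parameters persists in between. [folklore] -/
theorem gap_pos_between {p t : ℕ} {x y z : ℝ} (hxy : x ≤ y) (hyz : y ≤ z)
    (hx : 0 < gap t (L a b p x) (L a b t x)) (hz : 0 < gap t (L a b p z) (L a b t z)) :
    0 < gap t (L a b p y) (L a b t y) := by
  rw [gap_along_line] at hx hz ⊢
  exact affine_between_lt hxy hyz hx hz

/-- at the crossing abscissa of `p` and `q` the gap of `q` against `p` vanishes. [folklore] -/
theorem gap_crossAbs_eq_zero {p q : ℕ} (h : a p ≠ a q) :
    gap q (L a b p ((b q - b p) / (a p - a q))) (L a b q ((b q - b p) / (a p - a q))) = 0 := by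
  have h1 := L_eq_L_crossAbs a b h
  unfold gap
  split_ifs <;> linarith

/-! ## 2. Three partners of one line are impossible; at most two -/

/-- core: partners `q₁, q₂, q₃` of the base line `o` with crossing abscissae `τ₁ < τ₂ < τ₃`, the middle one a line of the family `T` whose gap
vanishes at `τ₂`, and every line of `T` other than `q₁` (resp. `q₃`) strictly correct against `o` at `τ₁` (resp. `τ₃`): impossible — `q₂` would
be strictly correct at `τ₁` and `τ₃`, hence at `τ₂`. [folklore] -/
theorem three_partners_core {o q₁ q₂ q₃ : ℕ} {T : Finset ℕ} {τ₁ τ₂ τ₃ : ℝ} (h12 : τ₁ < τ₂) (h23 : τ₂ < τ₃)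
    (hq₂ : q₂ ∈ T) (h21 : q₂ ≠ q₁) (h23' : q₂ ≠ q₃)
    (hz : gap q₂ (L a b o τ₂) (L a b q₂ τ₂) = 0)
    (h1 : ∀ t ∈ T, t ≠ q₁ → 0 < gap t (L a b o τ₁) (L a b t τ₁))
    (h3 : ∀ t ∈ T, t ≠ q₃ → 0 < gap t (L a b o τ₃) (L a b t τ₃)) : False := by
  have h := gap_pos_between a b h12.le h23.le (h1 q₂ hq₂ h21) (h3 q₂ hq₂ h23')
  rw [hz] at h
  exact lt_irrefl _ h

/-- **THREE PARTNERS OF ONE LINE ARE IMPOSSIBLE**: three distinct lines `q₁, q₂, q₃` of a family `T`, non-parallel to the base line `o`, each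
with every line of `T` other than itself strictly correct against `o` at its crossing with `o`, do not exist. [folklore] -/
theorem three_partners {o q₁ q₂ q₃ : ℕ} {T : Finset ℕ} (hd12 : q₁ ≠ q₂) (hd13 : q₁ ≠ q₃) (hd23 : q₂ ≠ q₃)
    (hq₁ : q₁ ∈ T) (hq₂ : q₂ ∈ T) (hq₃ : q₃ ∈ T)
    (hA₁ : a o ≠ a q₁) (hA₂ : a o ≠ a q₂) (hA₃ : a o ≠ a q₃)
    (h1 : ∀ t ∈ T, t ≠ q₁ → 0 < gap t (L a b o ((b q₁ - b o) / (a o - a q₁))) (L a b t ((b q₁ - b o) / (a o - a q₁))))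
    (h2 : ∀ t ∈ T, t ≠ q₂ → 0 < gap t (L a b o ((b q₂ - b o) / (a o - a q₂))) (L a b t ((b q₂ - b o) / (a o - a q₂))))
    (h3 : ∀ t ∈ T, t ≠ q₃ → 0 < gap t (L a b o ((b q₃ - b o) / (a o - a q₃))) (L a b t ((b q₃ - b o) / (a o - a q₃)))) :
    False := by
  set τ₁ := (b q₁ - b o) / (a o - a q₁) with hτ₁
  set τ₂ := (b q₂ - b o) / (a o - a q₂) with hτ₂
  set τ₃ := (b q₃ - b o) / (a o - a q₃) with hτ₃
  have hz₁ : gap q₁ (L a b o τ₁) (L a b q₁ τ₁) = 0 := gap_crossAbs_eq_zero a b hA₁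
  have hz₂ : gap q₂ (L a b o τ₂) (L a b q₂ τ₂) = 0 := gap_crossAbs_eq_zero a b hA₂
  have hz₃ : gap q₃ (L a b o τ₃) (L a b q₃ τ₃) = 0 := gap_crossAbs_eq_zero a b hA₃
  have hn12 : τ₁ ≠ τ₂ := by
    intro he; have h := h1 q₂ hq₂ (Ne.symm hd12); rw [he, hz₂] at h; exact lt_irrefl _ h
  have hn13 : τ₁ ≠ τ₃ := by
    intro he; have h := h1 q₃ hq₃ (Ne.symm hd13); rw [he, hz₃] at h; exact lt_irrefl _ h
  have hn23 : τ₂ ≠ τ₃ := by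
    intro he; have h := h2 q₃ hq₃ (Ne.symm hd23); rw [he, hz₃] at h; exact lt_irrefl _ h
  rcases lt_or_gt_of_ne hn12 with c12 | c12 <;> rcases lt_or_gt_of_ne hn23 with c23 | c23 <;>
    rcases lt_or_gt_of_ne hn13 with c13 | c13
  · exact three_partners_core a b c12 c23 hq₂ (Ne.symm hd12) hd23 hz₂ h1 h3
  · exact absurd (c12.trans c23) (not_lt.mpr c13.le)
  · exact three_partners_core a b c13 c23 hq₃ (Ne.symm hd13) (Ne.symm hd23) hz₃ h1 h2
  · exact three_partners_core a b c13 c12 hq₁ hd13 hd12 hz₁ h3 h2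
  · exact three_partners_core a b c12 c13 hq₁ hd12 hd13 hz₁ h2 h3
  · exact three_partners_core a b c23 c13 hq₃ (Ne.symm hd23) (Ne.symm hd13) hz₃ h2 h1
  · exact absurd (c23.trans c12) (not_lt.mpr c13.le)
  · exact three_partners_core a b c23 c12 hq₂ hd23 (Ne.symm hd12) hz₂ h3 h1

/-- **AT MOST TWO PARTNERS PER LINE**: in a family `T` of lines, at most two lines `q` non-parallel to the base line `o` have every line of `T`
other than themselves strictly correct against `o` at their crossing with `o`.  (With `T = (p, n]`, `o = p`: at most two (M)-pairs `(p, ·)` have a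
VIRTUAL right wall; with `T = [0, q)`, `o = q`: at most two (M)-pairs `(·, q)` have a virtual left wall — ORDER.md Proposition 1, class V.) [folklore] -/
theorem card_partners_le_two (o : ℕ) (T : Finset ℕ) :
    (T.filter (fun q => a o ≠ a q ∧
      ∀ t ∈ T, t ≠ q → 0 < gap t (L a b o ((b q - b o) / (a o - a q))) (L a b t ((b q - b o) / (a o - a q))))).card ≤ 2 := by
  by_contra h
  rw [not_le, two_lt_card] at h
  obtain ⟨q₁, hq₁, q₂, hq₂, q₃, hq₃, hd12, hd13, hd23⟩ := h
  rw [mem_filter] at hq₁ hq₂ hq₃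
  exact three_partners a b hd12 hd13 hd23 hq₁.1 hq₂.1 hq₃.1 hq₁.2.1 hq₂.2.1 hq₃.2.1 hq₁.2.2 hq₂.2.2 hq₃.2.2

/-! ## 3. Killing walls: a killed family is never alive elsewhere -/

/-- perturbation: if at `τ` every line of `T` other than `q` is strictly correct against the base line `o`, and `q` (non-parallel to `o`) has gap
zero, then at some nearby parameter EVERY line of `T` is strictly correct against `o`. [folklore] -/
theorem exists_all_pos_near {o q : ℕ} (T : Finset ℕ) (τ : ℝ) (hA : a o ≠ a q)
    (hz : gap q (L a b o τ) (L a b q τ) = 0)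
    (hpos : ∀ t ∈ T, t ≠ q → 0 < gap t (L a b o τ) (L a b t τ)) :
    ∃ θ, ∀ t ∈ T, 0 < gap t (L a b o θ) (L a b t θ) := by
  set U : Set ℝ := ⋂ t ∈ T.erase q, {θ | 0 < gap t (L a b o θ) (L a b t θ)} with hU
  have hUo : IsOpen U :=
    isOpen_biInter_finset fun t _ => isOpen_lt continuous_const (continuous_gap a b t o)
  have hmemU : ∀ θ, θ ∈ U ↔ ∀ t ∈ T, t ≠ q → 0 < gap t (L a b o θ) (L a b t θ) := by
    intro θ
    rw [hU]
    simp only [Set.mem_iInter, Set.mem_setOf_eq, Finset.mem_erase]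
    constructor
    · intro h t ht htq; exact h t ⟨htq, ht⟩
    · rintro h t ⟨htq, ht⟩; exact h t ht htq
  have hτU : τ ∈ U := (hmemU τ).mpr hpos
  obtain ⟨ε, hε, hball⟩ := Metric.isOpen_iff.mp hUo τ hτU
  -- slope of the gap of `q` along `o`, and a step of `ε/2` to the side where it becomes positive
  set s : ℝ := (if Even q then a q - a o else a o - a q) with hs
  have hs0 : s ≠ 0 := by
    rw [hs]; split_ifs
    · exact sub_ne_zero.mpr (Ne.symm hA)
    · exact sub_ne_zero.mpr hA
  set θ : ℝ := (if 0 < s then τ + ε / 2 else τ - ε / 2) with hθ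
  have hdist : dist θ τ < ε := by
    rw [Real.dist_eq, hθ]
    split_ifs
    · rw [show τ + ε / 2 - τ = ε / 2 by ring, abs_of_pos (by linarith)]; linarith
    · rw [show τ - ε / 2 - τ = -(ε / 2) by ring, abs_neg, abs_of_pos (by linarith)]; linarith
  have hθU : θ ∈ U := hball (Metric.mem_ball.mpr hdist)
  refine ⟨θ, fun t ht => ?_⟩
  by_cases htq : t = q
  · subst htq
    have e1 := gap_along_line a b o t θ
    have e2 := gap_along_line a b o t τ
    rw [hz] at e2
    rw [e1]
    have e3 : s * θ + (if Even t then b t - b o else b o - b t) = s * (θ - τ) := by linarith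
    rw [e3, hθ]
    split_ifs with hsp
    · rw [show τ + ε / 2 - τ = ε / 2 by ring]; positivity
    · have hsn : s < 0 := lt_of_le_of_ne (not_lt.mp hsp) hs0
      rw [show τ - ε / 2 - τ = -(ε / 2) by ring]; nlinarith
  · exact (hmemU θ).mp hθU t ht htq

/-- **A KILLED FAMILY IS NEVER ALIVE**: if the family `Kl` is killed (no parameter has all of `Kl` strictly correct against `o`) then it is not
contained in a family `A'` all of whose lines other than some partner `q'` of `o` are strictly correct against `o` at the crossing of `o` and `q'`
(near that crossing all of `A'` is alive).  For right walls `Kl = (p, c]`, `A' = (p, c')` with `c < c'`; for left walls `Kl = [z, q)`, `A' = (z', q)`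
with `z' < z`: so all partners of a line retired by a KILLING wall share the killing index. [folklore] -/
theorem not_killed_of_subset_alive {o q' : ℕ} {Kl A' : Finset ℕ} (hA' : a o ≠ a q')
    (hpos' : ∀ t ∈ A', t ≠ q' → 0 < gap t (L a b o ((b q' - b o) / (a o - a q'))) (L a b t ((b q' - b o) / (a o - a q'))))
    (hkill : ∀ θ, ¬ ∀ t ∈ Kl, 0 < gap t (L a b o θ) (L a b t θ)) (hsub : Kl ⊆ A') : False := by
  obtain ⟨θ, hθ⟩ := exists_all_pos_near a b A' ((b q' - b o) / (a o - a q')) hA' (gap_crossAbs_eq_zero a b hA') hpos'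
  exact hkill θ (fun t ht => hθ t (hsub ht))

/-- **AT MOST TWO PARTNERS PER LINE ARE RETIRED BY A KILLING RIGHT WALL** (ORDER.md Proposition 1, class K, right side): for each line `p`, at
most two lines `q > p` non-parallel to `p` admit a `c > q`, `c ≤ n`, with every line of `(p, c)` other than `q` strictly correct at the crossing
of `p` and `q` and NO parameter at which every line of `(p, c]` is strictly correct against `p`. [folklore] -/
theorem card_killedRight_le_two (n p : ℕ) :
    ((range (n + 1)).filter (fun q => p < q ∧ a p ≠ a q ∧ ∃ c, q < c ∧ c ≤ n ∧
      (∀ t, p < t → t < c → t ≠ q → 0 < gap t (L a b p ((b q - b p) / (a p - a q))) (L a b t ((b q - b p) / (a p - a q)))) ∧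
      (∀ θ, ¬ ∀ t, p < t → t ≤ c → 0 < gap t (L a b p θ) (L a b t θ)))).card ≤ 2 := by
  by_contra h
  rw [not_le, two_lt_card] at h
  obtain ⟨q₁, hq₁, q₂, hq₂, q₃, hq₃, hd12, hd13, hd23⟩ := h
  rw [mem_filter] at hq₁ hq₂ hq₃
  obtain ⟨-, hp₁, hA₁, c₁, hqc₁, hc₁n, hM₁, hK₁⟩ := hq₁
  obtain ⟨-, hp₂, hA₂, c₂, hqc₂, hc₂n, hM₂, hK₂⟩ := hq₂
  obtain ⟨-, hp₃, hA₃, c₃, hqc₃, hc₃n, hM₃, hK₃⟩ := hq₃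
  -- alive families `(p, cᵢ)` as finsets, killed families `(p, cᵢ]`
  have hal : ∀ q c, (∀ t, p < t → t < c → t ≠ q →
      0 < gap t (L a b p ((b q - b p) / (a p - a q))) (L a b t ((b q - b p) / (a p - a q)))) →
      ∀ t ∈ Ioo p c, t ≠ q → 0 < gap t (L a b p ((b q - b p) / (a p - a q))) (L a b t ((b q - b p) / (a p - a q))) :=
    fun q c h t ht htq => h t (mem_Ioo.mp ht).1 (mem_Ioo.mp ht).2 htq
  have hkl : ∀ c, (∀ θ, ¬ ∀ t, p < t → t ≤ c → 0 < gap t (L a b p θ) (L a b t θ)) →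
      ∀ θ, ¬ ∀ t ∈ Ioc p c, 0 < gap t (L a b p θ) (L a b t θ) :=
    fun c h θ hall => h θ (fun t h1 h2 => hall t (mem_Ioc.mpr ⟨h1, h2⟩))
  have hsame : ∀ c c', (∃ q, q < c ∧ ∀ θ, ¬ ∀ t ∈ Ioc p c, 0 < gap t (L a b p θ) (L a b t θ)) →
      (∃ q', a p ≠ a q' ∧ q' < c' ∧ ∀ t ∈ Ioo p c', t ≠ q' →
        0 < gap t (L a b p ((b q' - b p) / (a p - a q'))) (L a b t ((b q' - b p) / (a p - a q')))) → ¬ c < c' := by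
    rintro c c' ⟨q, hqc, hk⟩ ⟨q', hA', hqc', hpos'⟩ hlt
    refine not_killed_of_subset_alive a b hA' hpos' hk (fun t ht => ?_)
    rw [mem_Ioc] at ht; rw [mem_Ioo]; exact ⟨ht.1, by omega⟩
  have e12 : c₁ = c₂ := by
    by_contra hne
    rcases lt_or_gt_of_ne hne with h | h
    · exact hsame c₁ c₂ ⟨q₁, hqc₁, hkl c₁ hK₁⟩ ⟨q₂, hA₂, hqc₂, hal q₂ c₂ hM₂⟩ h
    · exact hsame c₂ c₁ ⟨q₂, hqc₂, hkl c₂ hK₂⟩ ⟨q₁, hA₁, hqc₁, hal q₁ c₁ hM₁⟩ h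
  have e13 : c₁ = c₃ := by
    by_contra hne
    rcases lt_or_gt_of_ne hne with h | h
    · exact hsame c₁ c₃ ⟨q₁, hqc₁, hkl c₁ hK₁⟩ ⟨q₃, hA₃, hqc₃, hal q₃ c₃ hM₃⟩ h
    · exact hsame c₃ c₁ ⟨q₃, hqc₃, hkl c₃ hK₃⟩ ⟨q₁, hA₁, hqc₁, hal q₁ c₁ hM₁⟩ h
  subst e12 e13
  exact three_partners a b (T := Ioo p c₁) hd12 hd13 hd23 (mem_Ioo.mpr ⟨hp₁, hqc₁⟩) (mem_Ioo.mpr ⟨hp₂, hqc₂⟩)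
    (mem_Ioo.mpr ⟨hp₃, hqc₃⟩) hA₁ hA₂ hA₃ (hal q₁ c₁ hM₁) (hal q₂ c₁ hM₂) (hal q₃ c₁ hM₃)

/-- **AT MOST TWO PARTNERS PER LINE ARE RETIRED BY A KILLING LEFT WALL** (class K, left side): for each line `q`, at most two lines `p < q`
non-parallel to `q` admit a `z < p` with every line of `(z, q)` other than `p` strictly correct against `q` at the crossing of `p` and `q` and NO
parameter at which every line of `[z, q)` is strictly correct against `q`. [folklore] -/
theorem card_killedLeft_le_two (n q : ℕ) :
    ((range (n + 1)).filter (fun p => p < q ∧ a q ≠ a p ∧ ∃ z, z < p ∧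
      (∀ t, z < t → t < q → t ≠ p → 0 < gap t (L a b q ((b p - b q) / (a q - a p))) (L a b t ((b p - b q) / (a q - a p)))) ∧
      (∀ θ, ¬ ∀ t, z ≤ t → t < q → 0 < gap t (L a b q θ) (L a b t θ)))).card ≤ 2 := by
  by_contra h
  rw [not_le, two_lt_card] at h
  obtain ⟨p₁, hp₁, p₂, hp₂, p₃, hp₃, hd12, hd13, hd23⟩ := h
  rw [mem_filter] at hp₁ hp₂ hp₃
  obtain ⟨-, hq₁, hA₁, z₁, hz₁, hM₁, hK₁⟩ := hp₁
  obtain ⟨-, hq₂, hA₂, z₂, hz₂, hM₂, hK₂⟩ := hp₂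
  obtain ⟨-, hq₃, hA₃, z₃, hz₃, hM₃, hK₃⟩ := hp₃
  have hal : ∀ p z, (∀ t, z < t → t < q → t ≠ p →
      0 < gap t (L a b q ((b p - b q) / (a q - a p))) (L a b t ((b p - b q) / (a q - a p)))) →
      ∀ t ∈ Ioo z q, t ≠ p → 0 < gap t (L a b q ((b p - b q) / (a q - a p))) (L a b t ((b p - b q) / (a q - a p))) :=
    fun p z h t ht htp => h t (mem_Ioo.mp ht).1 (mem_Ioo.mp ht).2 htp
  have hkl : ∀ z, (∀ θ, ¬ ∀ t, z ≤ t → t < q → 0 < gap t (L a b q θ) (L a b t θ)) →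
      ∀ θ, ¬ ∀ t ∈ Ico z q, 0 < gap t (L a b q θ) (L a b t θ) :=
    fun z h θ hall => h θ (fun t h1 h2 => hall t (mem_Ico.mpr ⟨h1, h2⟩))
  have hsame : ∀ z z', (∃ p, z < p ∧ ∀ θ, ¬ ∀ t ∈ Ico z q, 0 < gap t (L a b q θ) (L a b t θ)) →
      (∃ p', a q ≠ a p' ∧ z' < p' ∧ ∀ t ∈ Ioo z' q, t ≠ p' →
        0 < gap t (L a b q ((b p' - b q) / (a q - a p'))) (L a b t ((b p' - b q) / (a q - a p')))) → ¬ z' < z := by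
    rintro z z' ⟨p, hzp, hk⟩ ⟨p', hA', hzp', hpos'⟩ hlt
    refine not_killed_of_subset_alive a b hA' hpos' hk (fun t ht => ?_)
    rw [mem_Ico] at ht; rw [mem_Ioo]; exact ⟨by omega, ht.2⟩
  have e12 : z₁ = z₂ := by
    by_contra hne
    rcases lt_or_gt_of_ne hne with h | h
    · exact hsame z₂ z₁ ⟨p₂, hz₂, hkl z₂ hK₂⟩ ⟨p₁, hA₁, hz₁, hal p₁ z₁ hM₁⟩ h
    · exact hsame z₁ z₂ ⟨p₁, hz₁, hkl z₁ hK₁⟩ ⟨p₂, hA₂, hz₂, hal p₂ z₂ hM₂⟩ h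
  have e13 : z₁ = z₃ := by
    by_contra hne
    rcases lt_or_gt_of_ne hne with h | h
    · exact hsame z₃ z₁ ⟨p₃, hz₃, hkl z₃ hK₃⟩ ⟨p₁, hA₁, hz₁, hal p₁ z₁ hM₁⟩ h
    · exact hsame z₁ z₃ ⟨p₁, hz₁, hkl z₁ hK₁⟩ ⟨p₃, hA₃, hz₃, hal p₃ z₃ hM₃⟩ h
  subst e12 e13
  exact three_partners a b (T := Ioo z₁ q) hd12 hd13 hd23 (mem_Ioo.mpr ⟨hz₁, hq₁⟩) (mem_Ioo.mpr ⟨hz₂, hq₂⟩)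
    (mem_Ioo.mpr ⟨hz₃, hq₃⟩) hA₁ hA₂ hA₃ (hal p₁ z₁ hM₁) (hal p₂ z₁ hM₂) (hal p₃ z₁ hM₃)

/-! ## 4. Events with a virtual or killing right wall are at most `4 (n + 1)` -/

/-- **(M)-PAIRS WITH A VIRTUAL OR KILLING RIGHT WALL ARE AT MOST `4 (n + 1)`** (ORDER.md Proposition 1 and its corollary, right side).  Lines
`0..n` with pairwise distinct slopes; the pairs `p < q ≤ n` such that (M) every line strictly between `p` and `q` is strictly correct at their
vertex, and EITHER every later line `t ∈ (q, n]` is strictly correct there (VIRTUAL right wall) OR the first later line `c` incorrect there KILLS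
the window of `p` (no parameter has all of `(p, c]` strictly correct against `p`), number at most `4 (n + 1)` — at most `2 + 2` per line `p`
(`card_partners_le_two`, `card_killed_partners_le_two`).  No parity and no (L)/(R) clause is assumed, so this bounds in particular the EVENTS of
`…StaticPathMixedEvents` / `sweep_count_eq` whose right wall is not a cut; the cut–cut events are the open class of the ORDER QUESTION. [folklore] -/
theorem card_rightWall_virtual_or_killing_le (n : ℕ) (hslope : ∀ p q, p ≤ n → q ≤ n → p ≠ q → a p ≠ a q) :
    (((range (n + 1)) ×ˢ (range (n + 1))).filter (fun pq : ℕ × ℕ => pq.1 < pq.2 ∧ pq.2 ≤ n ∧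
        (∀ t, pq.1 < t → t < pq.2 →
          0 < gap t (L a b pq.1 ((b pq.2 - b pq.1) / (a pq.1 - a pq.2))) (L a b t ((b pq.2 - b pq.1) / (a pq.1 - a pq.2)))) ∧
        ((∀ t, pq.2 < t → t ≤ n →
            0 < gap t (L a b pq.1 ((b pq.2 - b pq.1) / (a pq.1 - a pq.2))) (L a b t ((b pq.2 - b pq.1) / (a pq.1 - a pq.2)))) ∨
          (∃ c, pq.2 < c ∧ c ≤ n ∧
            (∀ t, pq.2 < t → t < c →
              0 < gap t (L a b pq.1 ((b pq.2 - b pq.1) / (a pq.1 - a pq.2))) (L a b t ((b pq.2 - b pq.1) / (a pq.1 - a pq.2)))) ∧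
            ¬ 0 < gap c (L a b pq.1 ((b pq.2 - b pq.1) / (a pq.1 - a pq.2))) (L a b c ((b pq.2 - b pq.1) / (a pq.1 - a pq.2))) ∧
            (∀ θ, ¬ ∀ t, pq.1 < t → t ≤ c → 0 < gap t (L a b pq.1 θ) (L a b t θ)))))).card ≤ 4 * (n + 1) := by
  -- per line `p`: the virtual class `V p` and the killing class `K p`
  set V : ℕ → Finset ℕ := fun p => (range (n + 1)).filter (fun q => p < q ∧ q ≤ n ∧ a p ≠ a q ∧
      ∀ t, p < t → t ≤ n → t ≠ q →
        0 < gap t (L a b p ((b q - b p) / (a p - a q))) (L a b t ((b q - b p) / (a p - a q)))) with hV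
  set K : ℕ → Finset ℕ := fun p => (range (n + 1)).filter (fun q => p < q ∧ a p ≠ a q ∧ ∃ c, q < c ∧ c ≤ n ∧
      (∀ t, p < t → t < c → t ≠ q → 0 < gap t (L a b p ((b q - b p) / (a p - a q))) (L a b t ((b q - b p) / (a p - a q)))) ∧
      (∀ θ, ¬ ∀ t, p < t → t ≤ c → 0 < gap t (L a b p θ) (L a b t θ))) with hK
  have hVK : ∀ p, (V p ∪ K p).card ≤ 4 := by
    intro p
    refine (card_union_le _ _).trans ?_
    have h1 : (V p).card ≤ 2 := by
      refine le_trans (card_le_card ?_) (card_partners_le_two a b p (Ioc p n))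
      intro q hq
      rw [hV, mem_filter, mem_range] at hq
      rw [mem_filter, mem_Ioc]
      exact ⟨⟨hq.2.1, hq.2.2.1⟩, hq.2.2.2.1, fun t ht htq => hq.2.2.2.2 t (mem_Ioc.mp ht).1 (mem_Ioc.mp ht).2 htq⟩
    have h2 : (K p).card ≤ 2 := card_killedRight_le_two a b n p
    omega
  -- the pairs lie in the union over `p` of `{p} × (V p ∪ K p)`
  refine le_trans (card_le_card (t := (range (n + 1)).biUnion (fun p => ({p} : Finset ℕ) ×ˢ (V p ∪ K p))) ?_) ?_
  · rintro ⟨p, q⟩ hpq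
    rw [mem_filter, mem_product, mem_range, mem_range] at hpq
    obtain ⟨⟨hp, hq⟩, hlt, hqn, hM, hW⟩ := hpq
    rw [mem_biUnion]
    refine ⟨p, mem_range.mpr hp, ?_⟩
    rw [mem_product, mem_singleton, mem_union]
    refine ⟨rfl, ?_⟩
    have hA : a p ≠ a q := hslope p q (by omega) hqn (Nat.ne_of_lt hlt)
    rcases hW with hVirt | ⟨c, hqc, hcn, hMc, -, hkill⟩
    · left
      rw [hV, mem_filter, mem_range]
      refine ⟨hq, hlt, hqn, hA, fun t hpt htn htq => ?_⟩
      rcases lt_or_gt_of_ne htq with h | h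
      · exact hM t hpt h
      · exact hVirt t h htn
    · right
      rw [hK, mem_filter, mem_range]
      refine ⟨hq, hlt, hA, c, hqc, hcn, fun t hpt htc htq => ?_, hkill⟩
      rcases lt_or_gt_of_ne htq with h | h
      · exact hM t hpt h
      · exact hMc t h htc
  · refine card_biUnion_le.trans ?_
    calc ∑ p ∈ range (n + 1), (({p} : Finset ℕ) ×ˢ (V p ∪ K p)).card
        ≤ ∑ _p ∈ range (n + 1), 4 := sum_le_sum fun p _ => by rw [card_product, card_singleton, one_mul]; exact hVK p
      _ = 4 * (n + 1) := by rw [sum_const, card_range, smul_eq_mul, mul_comm]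

/-- **(M)-PAIRS WITH A VIRTUAL OR KILLING LEFT WALL ARE AT MOST `4 (n + 1)`** (ORDER.md Proposition 1, left side; the mirror statement, by the
same one-dimensional argument along the line `q`).  The pairs `p < q ≤ n` with (M) and EITHER every earlier line `t < p` strictly correct at the
vertex (VIRTUAL left wall) OR the first earlier line `z` incorrect there KILLS the window of `q` read leftwards (no parameter has all of `[z, q)`
strictly correct against `q`) number at most `4 (n + 1)`. [folklore] -/
theorem card_leftWall_virtual_or_killing_le (n : ℕ) (hslope : ∀ p q, p ≤ n → q ≤ n → p ≠ q → a p ≠ a q) :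
    (((range (n + 1)) ×ˢ (range (n + 1))).filter (fun pq : ℕ × ℕ => pq.1 < pq.2 ∧ pq.2 ≤ n ∧
        (∀ t, pq.1 < t → t < pq.2 →
          0 < gap t (L a b pq.1 ((b pq.2 - b pq.1) / (a pq.1 - a pq.2))) (L a b t ((b pq.2 - b pq.1) / (a pq.1 - a pq.2)))) ∧
        ((∀ t, t < pq.1 →
            0 < gap t (L a b pq.1 ((b pq.2 - b pq.1) / (a pq.1 - a pq.2))) (L a b t ((b pq.2 - b pq.1) / (a pq.1 - a pq.2)))) ∨
          (∃ z, z < pq.1 ∧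
            (∀ t, z < t → t < pq.1 →
              0 < gap t (L a b pq.1 ((b pq.2 - b pq.1) / (a pq.1 - a pq.2))) (L a b t ((b pq.2 - b pq.1) / (a pq.1 - a pq.2)))) ∧
            ¬ 0 < gap z (L a b pq.1 ((b pq.2 - b pq.1) / (a pq.1 - a pq.2))) (L a b z ((b pq.2 - b pq.1) / (a pq.1 - a pq.2))) ∧
            (∀ θ, ¬ ∀ t, z ≤ t → t < pq.2 → 0 < gap t (L a b pq.2 θ) (L a b t θ)))))).card ≤ 4 * (n + 1) := by
  -- per line `q`: the virtual class `V q` and the killing class `K q`, in the coordinates of line `q`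
  set V : ℕ → Finset ℕ := fun q => (range (n + 1)).filter (fun p => p < q ∧ a q ≠ a p ∧
      ∀ t, t < q → t ≠ p →
        0 < gap t (L a b q ((b p - b q) / (a q - a p))) (L a b t ((b p - b q) / (a q - a p)))) with hV
  set K : ℕ → Finset ℕ := fun q => (range (n + 1)).filter (fun p => p < q ∧ a q ≠ a p ∧ ∃ z, z < p ∧
      (∀ t, z < t → t < q → t ≠ p → 0 < gap t (L a b q ((b p - b q) / (a q - a p))) (L a b t ((b p - b q) / (a q - a p)))) ∧
      (∀ θ, ¬ ∀ t, z ≤ t → t < q → 0 < gap t (L a b q θ) (L a b t θ))) with hK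
  have hVK : ∀ q, (V q ∪ K q).card ≤ 4 := by
    intro q
    refine (card_union_le _ _).trans ?_
    have h1 : (V q).card ≤ 2 := by
      refine le_trans (card_le_card ?_) (card_partners_le_two a b q (Ico 0 q))
      intro p hp
      rw [hV, mem_filter, mem_range] at hp
      rw [mem_filter, mem_Ico]
      exact ⟨⟨Nat.zero_le _, hp.2.1⟩, hp.2.2.1, fun t ht htp => hp.2.2.2 t (mem_Ico.mp ht).2 htp⟩
    have h2 : (K q).card ≤ 2 := card_killedLeft_le_two a b n q
    omega
  refine le_trans (card_le_card (t := (range (n + 1)).biUnion (fun q => (V q ∪ K q) ×ˢ ({q} : Finset ℕ))) ?_) ?_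
  · rintro ⟨p, q⟩ hpq
    rw [mem_filter, mem_product, mem_range, mem_range] at hpq
    obtain ⟨⟨hp, hq⟩, hlt, hqn, hM, hW⟩ := hpq
    rw [mem_biUnion]
    refine ⟨q, mem_range.mpr hq, ?_⟩
    rw [mem_product, mem_singleton, mem_union]
    refine ⟨?_, rfl⟩
    have hA : a p ≠ a q := hslope p q (by omega) hqn (Nat.ne_of_lt hlt)
    -- the vertex in the coordinates of line `q`
    have e1 : (b p - b q) / (a q - a p) = (b q - b p) / (a p - a q) := crossAbs_symm a b q p
    have e2 : L a b q ((b q - b p) / (a p - a q)) = L a b p ((b q - b p) / (a p - a q)) := L_eq_L_crossAbs a b hA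
    simp only at hM hW ⊢
    rcases hW with hVirt | ⟨z, hzp, hMz, -, hkill⟩
    · left
      rw [hV, mem_filter, mem_range]
      refine ⟨hp, hlt, Ne.symm hA, fun t htq htp => ?_⟩
      rw [e1, e2]
      rcases lt_or_gt_of_ne htp with h | h
      · exact hVirt t h
      · exact hM t h htq
    · right
      rw [hK, mem_filter, mem_range]
      refine ⟨hp, hlt, Ne.symm hA, z, hzp, fun t hzt htq htp => ?_, hkill⟩
      rw [e1, e2]
      rcases lt_or_gt_of_ne htp with h | h
      · exact hMz t hzt h
      · exact hM t h htq
  · refine card_biUnion_le.trans ?_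
    calc ∑ q ∈ range (n + 1), ((V q ∪ K q) ×ˢ ({q} : Finset ℕ)).card
        ≤ ∑ _q ∈ range (n + 1), 4 := sum_le_sum fun q _ => by rw [card_product, card_singleton, mul_one]; exact hVK q
      _ = 4 * (n + 1) := by rw [sum_const, card_range, smul_eq_mul, mul_comm]

end

end StaticPathFold

end Summit.ValiantsHypothesis.ValiantsHypothesis.Theorems.KPlusLogSqLaw
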